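import Mathlib.FieldTheory.IntermediateField.Adjoin.Basic
import Mathlib.RingTheory.AlgebraicIndependent.TranscendenceBasis
import Mathlib.LinearAlgebra.Basis.VectorSpace
import Mathlib.LinearAlgebra.FiniteDimensional.Lemmas
import Mathlib.Analysis.SpecialFunctions.Complex.Log
import Literature.NumberTheory.Transcendental.SchanuelEclEmptyProofs
import Literature.Barriers.Schanuel.AlgebraicIndependenceOfLogarithms
import HarnessLib

/-!
# Sector splits of Schanuel's conjecture at a `ℚ`-subspace

Kirby (Bull. LMS 42 (2010), Prop. 7.2 with §1) reduces Schanuel's conjecture to tuples from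
`ecl ∅` by a `GL_n(ℚ)`-adapted basis of `span_ℚ x̄` and the tower law for transcendence degrees;
the tree proves that reduction as
`Literature.NumberTheory.Transcendental.schanuelConjecture_iff_ecl_empty_of_kirby`
(`SchanuelEclEmptyProofs.lean`). The SAME bookkeeping works for an arbitrary set `S ⊆ ℂ` in place
of `ecl ∅` — no closure property of `S` is used — and this file records it once, in the form the
routes `Schanuel/LogPatterns` (split at `𝓛 = exp⁻¹(ℚ̄)`), `Schanuel/GeodesicRealLogs` (split at
`𝓛 ∩ ℝ`), `Schanuel/AdelicLogSector` and `Schanuel/BenfordTowers` (split at `{log p}`) consume: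

* `schanuel_of_sector_split_set` : if (inside) every `ℚ`-linearly independent tuple `y` from
  `span_ℚ S` has `trdeg_ℚ ℚ(y) ≥ |y|` and (outside) every tuple `z` that is `ℚ`-independent modulo
  `span_ℚ S` has `trdeg_{ℚ(S)} ℚ(S)(z, e^z) ≥ |z|`, then Schanuel's conjecture
  (`∀ n, SchanuelRank n`, = `Literature.Periods.SchanuelConjecture` by `Iff.rfl`) holds.
* `le_trdeg_adjoin_of_algebraicIndependent'` : `k` algebraically independent numbers generate a
  field of `trdeg ≥ k`.
* `le_trdeg_adjoin_of_mem_span_of_algebraicIndependent` : `k` `ℚ`-independent vectors in the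
  `ℚ`-span of an algebraically independent tuple generate a field of `trdeg ≥ k` (linear sections
  of a transcendence basis).
* `isAlgebraic_exp_rat_mul` : `e^a ∈ ℚ̄ ⇒ e^{qa} ∈ ℚ̄` for `q ∈ ℚ`, whence `𝓛` and `𝓛 ∩ ℝ` are
  `ℚ`-subspaces (`span_setOf_isAlgebraic_exp`, `span_setOf_im_eq_zero_and_isAlgebraic_exp`:
  their `ℚ`-spans are the sets themselves).

## What is NOT here

No statement about any particular sector is asserted: the inside/outside hypotheses are exactly
the open route items (they are conjectures of Schanuel strength). Nothing about `ecl`.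

## References

* J. Kirby, *Exponential algebraicity in exponential fields*, Bull. Lond. Math. Soc. 42 (2010)
  879–890, Prop. 7.2 and §1 (the `GL_n(ℚ)` bookkeeping). [Kirby2010EAEF]
-/

noncomputable section

open IntermediateField

namespace Literature.NumberTheory.Transcendental

/-! ### Two transcendence-degree counts -/

/-- `k` algebraically independent complex numbers generate over `ℚ` a field of transcendence
degree `≥ k` (they stay algebraically independent inside `ℚ(y)`;
`AlgebraicIndependent.cardinalMk_le_trdeg`). [folklore] -/
theorem le_trdeg_adjoin_of_algebraicIndependent' {ι : Type} [Fintype ι] {y : ι → ℂ}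
    (h : AlgebraicIndependent ℚ y) :
    (Fintype.card ι : Cardinal) ≤ Algebra.trdeg ℚ ↥(adjoin ℚ (Set.range y)) := by
  let f : ι → adjoin ℚ (Set.range y) := fun i => ⟨y i, subset_adjoin ℚ _ ⟨i, rfl⟩⟩
  have hf : AlgebraicIndependent ℚ f := AlgebraicIndependent.of_comp (adjoin ℚ (Set.range y)).val h
  simpa using hf.cardinalMk_le_trdeg

open Submodule in
/-- **Linear sections of an algebraically independent tuple.** If `g : Fin r → ℂ` is
algebraically independent over `ℚ` and `y : Fin k → ℂ` is `ℚ`-linearly independent with values in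
`span_ℚ (range g)`, then `trdeg_ℚ ℚ(y) ≥ k`. Proof: complete `y` by a basis `w` of a complement of
`span (range y)` inside `span (range g)`; the `r`-tuple `(y, w)` generates a field containing `g`,
hence of transcendence degree `≥ r`, so it is algebraically independent
(`Literature.Barriers.Schanuel.algebraicIndependent_of_le_trdeg_adjoin`), and so is its
sub-family `y`. [folklore] -/
theorem le_trdeg_adjoin_of_mem_span_of_algebraicIndependent {r k : ℕ} {g : Fin r → ℂ}
    (hg : AlgebraicIndependent ℚ g) {y : Fin k → ℂ} (hy : ∀ i, y i ∈ span ℚ (Set.range g))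
    (hyli : LinearIndependent ℚ y) :
    (k : Cardinal) ≤ Algebra.trdeg ℚ ↥(adjoin ℚ (Set.range y)) := by
  have hgli : LinearIndependent ℚ g := hg.linearIndependent
  set V : Submodule ℚ ℂ := span ℚ (Set.range g) with hV
  haveI : FiniteDimensional ℚ V := FiniteDimensional.span_of_finite ℚ (Set.finite_range g)
  set Y : Submodule ℚ ℂ := span ℚ (Set.range y) with hY
  have hYV : Y ≤ V := span_le.mpr (Set.range_subset_iff.mpr hy)
  obtain ⟨U', hU'⟩ := Y.exists_isCompl
  set U : Submodule ℚ ℂ := V ⊓ U' with hU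
  haveI : FiniteDimensional ℚ Y := FiniteDimensional.span_of_finite ℚ (Set.finite_range y)
  haveI : FiniteDimensional ℚ U := Submodule.finiteDimensional_of_le inf_le_left
  have hYU_sup : Y ⊔ U = V := by
    rw [hU, inf_comm, ← sup_inf_assoc_of_le U' hYV, hU'.sup_eq_top, top_inf_eq]
  have hYU_disj : Disjoint Y U := hU'.disjoint.mono_right inf_le_right
  set s := Module.finrank ℚ U with hs
  have h2 : Module.finrank ℚ V = r := by
    rw [hV, finrank_span_eq_card hgli, Fintype.card_fin]
  have hks : k + s = r := by
    have h1 := Submodule.finrank_sup_add_finrank_inf_eq Y U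
    rw [hYU_disj.eq_bot, finrank_bot, add_zero, hYU_sup] at h1
    rw [hY, finrank_span_eq_card hyli, Fintype.card_fin] at h1
    rw [hs]
    omega
  let bU := Module.finBasis ℚ U
  let w : Fin s → ℂ := fun j => (bU j : ℂ)
  have hw_U : ∀ j, w j ∈ U := fun j => (bU j).2
  -- the combined family `l = (y, w)` indexed by `Fin (k + s)`
  let l : Fin (k + s) → ℂ := fun t => Sum.elim y w (finSumFinEquiv.symm t)
  have hrange : Set.range l = Set.range y ∪ Set.range w := by
    ext a
    simp only [Set.mem_range, Set.mem_union, l]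
    constructor
    · rintro ⟨t, rfl⟩
      rcases h : finSumFinEquiv.symm t with i | j
      · exact Or.inl ⟨i, by simp⟩
      · exact Or.inr ⟨j, by simp⟩
    · rintro (⟨i, rfl⟩ | ⟨j, rfl⟩)
      · exact ⟨finSumFinEquiv (Sum.inl i), by simp⟩
      · exact ⟨finSumFinEquiv (Sum.inr j), by simp⟩
  -- `g` lies in `span (range l) = Y ⊔ U = V`, hence in `ℚ(range l)`
  have hspan_l : span ℚ (Set.range l) = V := by
    rw [hrange, span_union, ← hYU_sup]
    congr 1
    -- `span (range w) = U`
    apply le_antisymm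
    · exact span_le.mpr (Set.range_subset_iff.mpr hw_U)
    · intro u hu
      have hb := bU.mem_span (⟨u, hu⟩ : U)
      have : (⟨u, hu⟩ : U) ∈ span ℚ (Set.range bU) := hb
      have hmap := Submodule.mem_map_of_mem (f := U.subtype) this
      rw [Submodule.map_span, ← Set.range_comp] at hmap
      exact hmap
  have hg_adj : ∀ i, g i ∈ adjoin ℚ (Set.range l) := by
    intro i
    have hgi : g i ∈ span ℚ (Set.range l) := by rw [hspan_l]; exact subset_span ⟨i, rfl⟩
    have hle : span ℚ (Set.range l) ≤ Subalgebra.toSubmodule (adjoin ℚ (Set.range l)).toSubalgebra :=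
      span_le.mpr (fun a ha => subset_adjoin ℚ _ ha)
    exact hle hgi
  have hadj_le : adjoin ℚ (Set.range g) ≤ adjoin ℚ (Set.range l) := by
    rw [adjoin_le_iff]; rintro a ⟨i, rfl⟩; exact hg_adj i
  have htr : ((k + s : ℕ) : Cardinal) ≤ Algebra.trdeg ℚ ↥(adjoin ℚ (Set.range l)) := by
    calc ((k + s : ℕ) : Cardinal) = (Fintype.card (Fin r) : Cardinal) := by
            rw [hks, Fintype.card_fin]
      _ ≤ Algebra.trdeg ℚ ↥(adjoin ℚ (Set.range g)) := le_trdeg_adjoin_of_algebraicIndependent' hg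
      _ ≤ Algebra.trdeg ℚ ↥(adjoin ℚ (Set.range l)) :=
            trdeg_le_of_injective (inclusion hadj_le) (inclusion_injective hadj_le)
  have hl_ai : AlgebraicIndependent ℚ l :=
    Literature.Barriers.Schanuel.algebraicIndependent_of_le_trdeg_adjoin l htr
  -- `y` is the sub-family of `l` along `Sum.inl`
  have hy_ai : AlgebraicIndependent ℚ y := by
    have hcomp : AlgebraicIndependent ℚ (l ∘ (fun i : Fin k => finSumFinEquiv (Sum.inl i))) :=
      hl_ai.comp _ (fun a b hab => by simpa using hab)
    have hfun : (l ∘ fun i : Fin k => finSumFinEquiv (Sum.inl i)) = y := by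
      funext i; simp [l]
    rwa [hfun] at hcomp
  simpa using le_trdeg_adjoin_of_algebraicIndependent' hy_ai

open Submodule in
/-- **Sector split of Schanuel's conjecture at a set** (Kirby's `GL_n(ℚ)` bookkeeping, Kirby
2010 Prop. 7.2/§1, with `ecl ∅` replaced by an arbitrary `S ⊆ ℂ`). Let `S ⊆ ℂ`. If (inside) every
`ℚ`-linearly independent tuple `y` with values in `span_ℚ S` satisfies `trdeg_ℚ ℚ(y) ≥ |y|`, and
(outside) every tuple `z` that is `ℚ`-linearly independent modulo `span_ℚ S` satisfies
`trdeg_{ℚ(S)} ℚ(S)(z, e^z) ≥ |z|`, then Schanuel's conjecture `∀ n, SchanuelRank n` holds.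
Proof: for `ℚ`-independent `x̄` put `V = span x̄`, `W = V ⊓ span S`, `U` a complement of `W` in
`V`, bases `y` of `W` and `z` of `U` cleared of denominators so that they lie in the `ℤ`-span of
`x̄`; then `k ≤ trdeg_ℚ ℚ(y)` (inside), `m ≤ trdeg_{ℚ(S)} ℚ(S)(z,e^z) ≤ trdeg_{ℚ(y)} ℚ(y)(z,e^z)`
(outside + base change along `ℚ(y) ≤ ℚ(S)`), the tower law gives `k + m = n ≤ trdeg ℚ(y, z, e^z)`
and `ℚ(y, z, e^z) ≤ ℚ(x̄, e^{x̄})`. [cite: Kirby2010EAEF, Prop. 7.2 and §1 (GL_n(ℚ) bookkeeping, ecl ∅ replaced by a set S)] -/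
theorem schanuel_of_sector_split_set (S : Set ℂ)
    (hIn : ∀ (k : ℕ) (y : Fin k → ℂ), (∀ i, y i ∈ span ℚ S) → LinearIndependent ℚ y →
      (k : Cardinal) ≤ Algebra.trdeg ℚ ↥(adjoin ℚ (Set.range y)))
    (hO : ∀ (m : ℕ) (z : Fin m → ℂ), LinearIndependent ℚ ((span ℚ S).mkQ ∘ z) →
      (m : Cardinal) ≤ Algebra.trdeg ↥(adjoin ℚ S)
        ↥(adjoin ↥(adjoin ℚ S) (Set.range z ∪ Set.range (Complex.exp ∘ z)))) :
    ∀ n, SchanuelRank n := by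
  intro n x hx
  set Eq : Submodule ℚ ℂ := span ℚ S with hEqdef
  -- the `ℚ`-span `V` of `x̄`, `W = V ∩ E` and a complement `U` of `W` in `V`
  set V : Submodule ℚ ℂ := span ℚ (Set.range x) with hV
  haveI : FiniteDimensional ℚ V := FiniteDimensional.span_of_finite ℚ (Set.finite_range x)
  set W : Submodule ℚ ℂ := V ⊓ Eq with hW
  obtain ⟨U', hU'⟩ := W.exists_isCompl
  set U : Submodule ℚ ℂ := V ⊓ U' with hU
  haveI : FiniteDimensional ℚ W := Submodule.finiteDimensional_of_le inf_le_left
  haveI : FiniteDimensional ℚ U := Submodule.finiteDimensional_of_le inf_le_left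
  have hWU_sup : W ⊔ U = V := by
    rw [hU, inf_comm, ← sup_inf_assoc_of_le U' (inf_le_left : W ≤ V), hU'.sup_eq_top, top_inf_eq]
  have hWU_disj : Disjoint W U := hU'.disjoint.mono_right inf_le_right
  have hUE_disj : Disjoint U Eq := by
    rw [disjoint_def]
    intro a haU haE
    exact (disjoint_def.mp hWU_disj) a ⟨inf_le_left (b := U') haU, haE⟩ haU
  -- dimensions
  set k := Module.finrank ℚ W
  set m := Module.finrank ℚ U
  have hn : k + m = n := by
    have h1 := Submodule.finrank_sup_add_finrank_inf_eq W U
    rw [hWU_disj.eq_bot, finrank_bot, add_zero, hWU_sup] at h1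
    rw [← h1, hV, finrank_span_eq_card hx, Fintype.card_fin]
  -- bases
  let bW := Module.finBasis ℚ W
  let bU := Module.finBasis ℚ U
  let y : Fin k → ℂ := fun i => (bW i : ℂ)
  let z : Fin m → ℂ := fun j => (bU j : ℂ)
  have hy_mem : ∀ i, y i ∈ Eq := fun i => ((bW i).2 : (bW i : ℂ) ∈ V ⊓ Eq).2
  have hy_V : ∀ i, y i ∈ V := fun i => ((bW i).2 : (bW i : ℂ) ∈ V ⊓ Eq).1
  have hz_U : ∀ j, z j ∈ U := fun j => (bU j).2
  have hz_V : ∀ j, z j ∈ V := fun j => inf_le_left (b := U') (hz_U j)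
  have hy_li : LinearIndependent ℚ y := bW.linearIndependent.map' W.subtype W.ker_subtype
  have hz_li : LinearIndependent ℚ z := bU.linearIndependent.map' U.subtype U.ker_subtype
  -- clearing denominators
  choose Ny hNy hNy_mem using fun i =>
    Literature.NumberTheory.Transcendental.exists_nsmul_mem_span_int x (hy_V i)
  choose Nz hNz hNz_mem using fun j =>
    Literature.NumberTheory.Transcendental.exists_nsmul_mem_span_int x (hz_V j)
  let cy : Fin k → ℚˣ := fun i => Units.mk0 (Ny i : ℚ) (Nat.cast_ne_zero.mpr (hNy i))
  let cz : Fin m → ℚˣ := fun j => Units.mk0 (Nz j : ℚ) (Nat.cast_ne_zero.mpr (hNz j))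
  let y' : Fin k → ℂ := fun i => (Ny i : ℚ) • y i
  let z' : Fin m → ℂ := fun j => (Nz j : ℚ) • z j
  have hy'_eq : cy • y = y' := by
    funext i; simp only [Pi.smul_apply', cy, y', Units.smul_def, Units.val_mk0]
  have hz'_eq : cz • z = z' := by
    funext j; simp only [Pi.smul_apply', cz, z', Units.smul_def, Units.val_mk0]
  have hy'_li : LinearIndependent ℚ y' := hy'_eq ▸ hy_li.units_smul cy
  have hz'_li : LinearIndependent ℚ z' := hz'_eq ▸ hz_li.units_smul cz
  have hy'_mem : ∀ i, y' i ∈ Eq := fun i => Eq.smul_mem _ (hy_mem i)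
  have hz'_U : ∀ j, z' j ∈ U := fun j => U.smul_mem _ (hz_U j)
  have hz'_modE : LinearIndependent ℚ ((span ℚ S).mkQ ∘ z') := by
    refine hz'_li.map ?_
    rw [ker_mkQ]
    exact hUE_disj.mono_left (span_le.mpr (Set.range_subset_iff.mpr hz'_U))
  -- the field-theoretic estimate
  set Sz := Set.range z' ∪ Set.range (Complex.exp ∘ z') with hSz
  set Ky := adjoin ℚ (Set.range y') with hKy
  set L := adjoin ℚ S with hL
  have hk : (k : Cardinal) ≤ Algebra.trdeg ℚ Ky := hIn k y' hy'_mem hy'_li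
  have hm₀ : (m : Cardinal) ≤ Algebra.trdeg L (adjoin L Sz) := hO m z' hz'_modE
  have hEqL : ∀ a ∈ Eq, a ∈ L := by
    intro a ha
    have hle : span ℚ S ≤ Subalgebra.toSubmodule L.toSubalgebra :=
      span_le.mpr (fun s hs => subset_adjoin ℚ S hs)
    exact hle ha
  have hKyL : Ky ≤ L := by
    rw [hKy, adjoin_le_iff]
    rintro a ⟨i, rfl⟩
    exact hEqL _ (hy'_mem i)
  have hm : (m : Cardinal) ≤ Algebra.trdeg Ky (adjoin Ky Sz) :=
    hm₀.trans (Literature.NumberTheory.Transcendental.trdeg_adjoin_le_of_le hKyL Sz)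
  have hkm : (k : Cardinal) + m ≤ Algebra.trdeg ℚ (adjoin ℚ (Set.range y' ∪ Sz)) :=
    Literature.NumberTheory.Transcendental.add_le_trdeg_adjoin_union (Set.range y') Sz hk hm
  -- comparison with `ℚ(x̄, e^{x̄})`
  set Kx := adjoin ℚ (Set.range x ∪ Set.range (Complex.exp ∘ x)) with hKx
  have hle : adjoin ℚ (Set.range y' ∪ Sz) ≤ Kx := by
    rw [adjoin_le_iff]
    rintro a (⟨i, rfl⟩ | (⟨j, rfl⟩ | ⟨j, rfl⟩))
    · exact (Literature.NumberTheory.Transcendental.mem_adjoin_of_mem_span_int x (hNy_mem i)).1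
    · exact (Literature.NumberTheory.Transcendental.mem_adjoin_of_mem_span_int x (hNz_mem j)).1
    · exact (Literature.NumberTheory.Transcendental.mem_adjoin_of_mem_span_int x (hNz_mem j)).2
  have hfin : Algebra.trdeg ℚ (adjoin ℚ (Set.range y' ∪ Sz)) ≤ Algebra.trdeg ℚ Kx :=
    trdeg_le_of_injective (inclusion hle) (inclusion_injective hle)
  calc (n : Cardinal) = (k : Cardinal) + m := by rw [← hn, Nat.cast_add]
    _ ≤ Algebra.trdeg ℚ (adjoin ℚ (Set.range y' ∪ Sz)) := hkm
    _ ≤ Algebra.trdeg ℚ Kx := hfin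

/-! ### `𝓛` and `𝓛 ∩ ℝ` are `ℚ`-subspaces of `ℂ` -/

/-- Integer powers of an algebraic number are algebraic. [folklore] -/
theorem isAlgebraic_zpow_rat {x : ℂ} (hx : IsAlgebraic ℚ x) (n : ℤ) : IsAlgebraic ℚ (x ^ n) := by
  cases n with
  | ofNat k => rw [Int.ofNat_eq_natCast, zpow_natCast]; exact hx.pow k
  | negSucc k => rw [zpow_negSucc]; exact (hx.pow (k + 1)).inv

/-- If `e^a` is algebraic then so is `e^{qa}` for every rational `q`
(`(e^{qa})^{den q} = (e^a)^{num q}` and `IsAlgebraic.of_pow`). [folklore] -/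
theorem isAlgebraic_exp_rat_mul {a : ℂ} (ha : IsAlgebraic ℚ (Complex.exp a)) (q : ℚ) :
    IsAlgebraic ℚ (Complex.exp ((q : ℂ) * a)) := by
  have hd : 0 < q.den := q.den_pos
  refine IsAlgebraic.of_pow hd ?_
  have h1 : Complex.exp ((q : ℂ) * a) ^ q.den = Complex.exp ((q.num : ℂ) * a) := by
    rw [← Complex.exp_nat_mul, ← mul_assoc]
    congr 2
    have h2 : ((q.den : ℚ) : ℂ) * (q : ℂ) = ((q.num : ℚ) : ℂ) := by
      rw [← Rat.cast_mul, Rat.den_mul_eq_num]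
    push_cast at h2
    exact h2
  rw [h1, Complex.exp_int_mul]
  exact isAlgebraic_zpow_rat ha q.num

/-- `𝓛 = exp⁻¹(ℚ̄)` is a `ℚ`-subspace of `ℂ`: the `ℚ`-span of `{z : e^z algebraic}` is the set
itself (`e^{a+b} = e^a e^b`, `e^0 = 1`, `e^{qa}` algebraic by `isAlgebraic_exp_rat_mul`). [folklore] -/
theorem isAlgebraic_exp_of_mem_span {z : ℂ}
    (hz : z ∈ Submodule.span ℚ {z : ℂ | IsAlgebraic ℚ (Complex.exp z)}) :
    IsAlgebraic ℚ (Complex.exp z) := by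
  induction hz using Submodule.span_induction with
  | mem x hx => exact hx
  | zero => rw [Complex.exp_zero]; exact isAlgebraic_one
  | add x y _ _ hx hy => rw [Complex.exp_add]; exact hx.mul hy
  | smul q x _ hx => rw [Rat.smul_def]; exact isAlgebraic_exp_rat_mul hx q

/-- `span_ℚ 𝓛 = 𝓛` as sets. [folklore] -/
theorem span_setOf_isAlgebraic_exp :
    (Submodule.span ℚ {z : ℂ | IsAlgebraic ℚ (Complex.exp z)} : Set ℂ) =
      {z : ℂ | IsAlgebraic ℚ (Complex.exp z)} :=
  Set.Subset.antisymm (fun _ hz => isAlgebraic_exp_of_mem_span hz) Submodule.subset_span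

/-- `𝓛_ℝ = 𝓛 ∩ ℝ` (real logarithms of positive real algebraic numbers) is a `ℚ`-subspace of `ℂ`:
an element of the `ℚ`-span of `{z : Im z = 0, e^z algebraic}` lies in that set. [folklore] -/
theorem im_eq_zero_and_isAlgebraic_exp_of_mem_span {z : ℂ}
    (hz : z ∈ Submodule.span ℚ {z : ℂ | z.im = 0 ∧ IsAlgebraic ℚ (Complex.exp z)}) :
    z.im = 0 ∧ IsAlgebraic ℚ (Complex.exp z) := by
  induction hz using Submodule.span_induction with
  | mem x hx => exact hx
  | zero => exact ⟨Complex.zero_im, by rw [Complex.exp_zero]; exact isAlgebraic_one⟩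
  | add x y _ _ hx hy =>
    refine ⟨by rw [Complex.add_im, hx.1, hy.1, add_zero], ?_⟩
    rw [Complex.exp_add]
    exact hx.2.mul hy.2
  | smul q x _ hx =>
    refine ⟨?_, ?_⟩
    · rw [Rat.smul_def, Complex.mul_im, hx.1, Complex.ratCast_im]
      ring
    · rw [Rat.smul_def]
      exact isAlgebraic_exp_rat_mul hx.2 q

/-- `span_ℚ 𝓛_ℝ = 𝓛_ℝ` as sets. [folklore] -/
theorem span_setOf_im_eq_zero_and_isAlgebraic_exp :
    (Submodule.span ℚ {z : ℂ | z.im = 0 ∧ IsAlgebraic ℚ (Complex.exp z)} : Set ℂ) =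
      {z : ℂ | z.im = 0 ∧ IsAlgebraic ℚ (Complex.exp z)} :=
  Set.Subset.antisymm (fun _ hz => im_eq_zero_and_isAlgebraic_exp_of_mem_span hz)
    Submodule.subset_span

end Literature.NumberTheory.Transcendental

end
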